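import Summits.Ventures.HodgeRepro2.T5SubrepTransport

/-!
# T5FiniteSumDecomposition — a finite orthogonal sum of decomposable subrepresentations is
decomposable

Cell pub-hodge-repro2, seat p5, Tier 5 (route/T5-N4-p5.md, N4.3 v13 (A3) STEP 1 – STEP 2: «L^{K_f}
= ⊕_{i=1}^{h} L²(Γ_i\G_∞) as unitary G_∞-modules … hence, by STEP 1, L^{K_f} = ⊕̂_π m_{K_f}(π) H_π
with m_{K_f}(π) := Σ_{i=1}^{h} m(π, Γ_i) < ∞»).  The abstract content of that «hence»:

* `HasDecomposition ρ`: the conclusion of [DE] Theorem 9.2.2 as a predicate on a unitary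
  representation (rows 59 / 65 / 70) — a set of irreducible closed stable subspaces, pairwise
  orthogonal, with dense sum, every unitary-equivalence class FINITE;
* **`hasDecomposition_of_finite_sum`**: if `E` is the closure of a FINITE family of closed, stable,
  pairwise orthogonal subspaces `W i`, each of which (with the restricted representation) has a
  decomposition, then so has `E`: the decomposition is the union of the images (row 71's
  transport of irreducibility, orthogonality within and across the summands, density, and the
  finiteness of every class — a class in `E` meets each summand in a class there, by the symmetry
  and transitivity of unitary equivalence on stable subspaces).

With rows 45 (the component Hilbert sum) and 67 / 70 (the decomposition on every component) this
is the sentence «m_{K_f}(π) = Σ_i m(π, Γ_i) < ∞» of STEP 2, modulo the identification of the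
summands `V_q ≅ L²(Γ_q\G_∞)` that STEP 1 states (prose).  Imports row 71 (hence p1's `T5RestrictionRep`) and Mathlib.
Axioms: propext, Classical.choice, Quot.sound.
README §8(d): uses an L-value-free non-vanishing device: NO.
-/

namespace Summit.Ventures.HodgeRepro2.T5FiniteSumDecomposition

open Summit.Ventures.HodgeRepro2.T5CompactDiscreteDecomposition (IrreducibleOn)
open Summit.Ventures.HodgeRepro2.T5FiniteMultiplicity (IsUnitaryEquiv)
open Summit.Ventures.HodgeRepro2.T5SubrepTransport
open Summit.Ventures.HodgeRepro2.T5CompleteReducibility (IsStable)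
open Summit.Ventures.HodgeRepro2.T5RestrictionRep (restrictRep)
open scoped InnerProductSpace

variable {E : Type*} [NormedAddCommGroup E] [InnerProductSpace ℂ E] {G : Type*} [Group G]

/-- **A DECOMPOSITION** of the representation `ρ` (the conclusion of [DE] Theorem 9.2.2, rows 59 /
65 / 70): a set `S` of irreducible closed `ρ`-stable subspaces, pairwise orthogonal, whose sum is
dense, every unitary-equivalence class of which is FINITE. -/
def HasDecomposition (ρ : G →* (E →L[ℂ] E)) : Prop :=
  ∃ S : Set (Submodule ℂ E), (∀ U ∈ S, IrreducibleOn ρ U) ∧ S.Pairwise (fun U V => U ⟂ V) ∧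
    (sSup S).topologicalClosure = ⊤ ∧ ∀ U₀ ∈ S, {U ∈ S | IsUnitaryEquiv ρ U₀ U}.Finite

variable {ρ : G →* (E →L[ℂ] E)}

/-- Membership in the union of the images of the summands' decompositions. -/
theorem mem_iUnion_image_iff {ι : Type*} (W : ι → Submodule ℂ E)
    (S : ∀ i, Set (Submodule ℂ (W i))) (U : Submodule ℂ E) :
    U ∈ ⋃ i, (fun U' : Submodule ℂ (W i) => U'.map (W i).subtype) '' S i ↔
      ∃ i, ∃ U' ∈ S i, U'.map (W i).subtype = U := by
  simp only [Set.mem_iUnion, Set.mem_image]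

/-- **A finite orthogonal sum of decomposable subrepresentations is decomposable.** -/
theorem hasDecomposition_of_finite_sum {ι : Type*} [Finite ι] (W : ι → Submodule ℂ E)
    (hWc : ∀ i, IsClosed (W i : Set E)) (hWs : ∀ i, IsStable ρ (W i))
    (hWo : Pairwise fun i j => W i ⟂ W j) (hWd : (⨆ i, W i).topologicalClosure = ⊤)
    (hS : ∀ i, HasDecomposition (restrictRep ρ (W i) (hWs i))) : HasDecomposition ρ := by
  choose S hSi hSo hSd hSf using hS
  refine ⟨⋃ i, (fun U' : Submodule ℂ (W i) => U'.map (W i).subtype) '' S i, ?_, ?_, ?_, ?_⟩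
  · -- irreducibility
    intro U hU
    obtain ⟨i, U', hU', rfl⟩ := (mem_iUnion_image_iff W S U).1 hU
    exact irreducibleOn_map_subtype (hWc i) (hSi i U' hU')
  · -- pairwise orthogonality
    intro U hU V hV hUV
    obtain ⟨i, U', hU', rfl⟩ := (mem_iUnion_image_iff W S U).1 hU
    obtain ⟨j, V', hV', rfl⟩ := (mem_iUnion_image_iff W S V).1 hV
    by_cases hij : i = j
    · subst hij
      have hne : U' ≠ V' := fun h => hUV (by rw [h])
      have horth : U' ⟂ V' := hSo i hU' hV' hne
      rw [Submodule.isOrtho_iff_inner_eq] at horth ⊢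
      intro u hu v hv
      obtain ⟨u', hu', rfl⟩ := Submodule.mem_map.1 hu
      obtain ⟨v', hv', rfl⟩ := Submodule.mem_map.1 hv
      exact horth u' hu' v' hv'
    · exact (hWo hij).mono (map_subtype_le U') (map_subtype_le V')
  · -- density
    apply le_antisymm le_top
    rw [← hWd]
    refine Submodule.topologicalClosure_minimal _ ?_ (Submodule.isClosed_topologicalClosure _)
    refine iSup_le fun i => ?_
    intro w hw
    have h1 : (⟨w, hw⟩ : W i) ∈ (sSup (S i)).topologicalClosure := by
      rw [hSd i]; exact Submodule.mem_top
    rw [← SetLike.mem_coe, Submodule.topologicalClosure_coe] at h1 ⊢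
    have h2 : Subtype.val '' closure ((sSup (S i) : Submodule ℂ (W i)) : Set (W i)) ⊆
        closure (Subtype.val '' ((sSup (S i) : Submodule ℂ (W i)) : Set (W i))) :=
      image_closure_subset_closure_image continuous_subtype_val
    have h3 : Subtype.val '' ((sSup (S i) : Submodule ℂ (W i)) : Set (W i)) ⊆
        ((sSup (⋃ i, (fun U' : Submodule ℂ (W i) => U'.map (W i).subtype) '' S i) :
          Submodule ℂ E) : Set E) := by
      rw [show Subtype.val '' ((sSup (S i) : Submodule ℂ (W i)) : Set (W i)) =
          ((Submodule.map (W i).subtype (sSup (S i)) : Submodule ℂ E) : Set E) by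
          rw [Submodule.map_coe, Submodule.coe_subtype]]
      apply SetLike.coe_subset_coe.2
      rw [sSup_eq_iSup' (S i), Submodule.map_iSup]
      exact iSup_le fun U' => le_sSup (Set.mem_iUnion.2 ⟨i, Set.mem_image_of_mem _ U'.2⟩)
    exact closure_mono h3 (h2 ⟨_, h1, rfl⟩)
  · -- finiteness of the unitary-equivalence classes
    intro U₀ hU₀
    obtain ⟨j, U₀', hU₀', rfl⟩ := (mem_iUnion_image_iff W S U₀).1 hU₀
    have hU₀s : IsStable ρ (U₀'.map (W j).subtype) :=
      (irreducibleOn_map_subtype (hWc j) (hSi j U₀' hU₀')).2.1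
    have hsplit : {U ∈ ⋃ i, (fun U' : Submodule ℂ (W i) => U'.map (W i).subtype) '' S i |
        IsUnitaryEquiv ρ (U₀'.map (W j).subtype) U} =
        ⋃ i, {U ∈ (fun U' : Submodule ℂ (W i) => U'.map (W i).subtype) '' S i |
          IsUnitaryEquiv ρ (U₀'.map (W j).subtype) U} := by
      ext U
      simp only [Set.mem_setOf_eq, Set.mem_iUnion]
      constructor
      · rintro ⟨⟨i, hi⟩, h⟩; exact ⟨i, hi, h⟩
      · rintro ⟨i, hi, h⟩; exact ⟨⟨i, hi⟩, h⟩
    rw [hsplit]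
    refine Set.finite_iUnion fun i => ?_
    by_cases hex : ∃ U₁' ∈ S i, IsUnitaryEquiv ρ (U₀'.map (W j).subtype) (U₁'.map (W i).subtype)
    · obtain ⟨U₁', hU₁', hequiv⟩ := hex
      have hU₁s : IsStable (restrictRep ρ (W i) (hWs i)) U₁' := (hSi i U₁' hU₁').2.1
      refine ((hSf i U₁' hU₁').image
        (fun U' : Submodule ℂ (W i) => U'.map (W i).subtype)).subset ?_
      rintro U ⟨⟨U', hU', rfl⟩, hUeq⟩
      refine ⟨U', ⟨hU', ?_⟩, rfl⟩
      have h1 : IsUnitaryEquiv ρ (U₁'.map (W i).subtype) (U₀'.map (W j).subtype) :=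
        isUnitaryEquiv_symm hU₀s hequiv
      have h2 : IsUnitaryEquiv ρ (U₁'.map (W i).subtype) (U'.map (W i).subtype) :=
        isUnitaryEquiv_trans hU₀s h1 hUeq
      exact isUnitaryEquiv_of_map_subtype hU₁s h2
    · push Not at hex
      convert Set.finite_empty
      ext U
      simp only [Set.mem_setOf_eq, Set.mem_image, Set.mem_empty_iff_false, iff_false, not_and]
      rintro ⟨U', hU', rfl⟩ h
      exact hex U' hU' h

end Summit.Ventures.HodgeRepro2.T5FiniteSumDecomposition
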